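import Summits.QuantumFields.YangMills.Theses.CoincidenceRotationBootstrap
import Summits.QuantumFields.YangMills.Theses.ScalingWindowSplit
import Summits.QuantumFields.YangMills.Theorems.LangevinControlUVOSLegsFromFemtoAndGapStubUpgradeGivens
import Literature.MathematicalPhysics.QuantumFieldTheory.SchwingerLimitInheritance
import Summits.QuantumFields.YangMills.Theorems.ScalingWindowSplitCurvatureAmnesiaStubSeparatedTensorsTotal
import Summits.QuantumFields.YangMills.Theorems.ScalingWindowSplitCurvatureAmnesiaStubAngleCalculus
import Summits.QuantumFields.YangMills.Theorems.ScalingWindowSplitCurvatureAmnesiaStubUniformOfPointwise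
import Summits.QuantumFields.YangMills.Theorems.ScalingWindowSplitCurvatureAmnesiaOfWardNullity
import Summits.QuantumFields.YangMills.Theorems.ScalingWindowSplitCurvatureAmnesiaStubWardNullityOne
import Summits.QuantumFields.YangMills.Theorems.ScalingWindowSplitCurvatureAmnesiaIffWardNullity
import HarnessLib.Audit

/-!
# Line `WardDefectSketch` (idea `ward-defect-weak-coupling`) for crux `CurvatureAmnesia`
(item stmt-QuantumFields-16192) — the lead's registered skeleton, v8 (gen-1 continuation lead c4, cycle 5: composition and
registered crux stub identical to v6/v7 — the EQUIVALENCE CERTIFICATE `CurvatureAmnesia ↔ (W₂)` is LANDED, p157344, so the open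
residue of this line is certified to be the crux itself; cycle 5 registers four ENGINE-PREREQUISITE sub-goals of the card's C⁺
(transport of the lattice gap to every axis, exact lattice translation covariance of `latticeSchwinger`, Schwartz-topology
convergence of lattice difference quotients, the W⁺ Λ²-selection rule) as `stub-add` sub-goals proved `--supports`, see §4)

Crux decl `Summit.QuantumFields.YangMills.Theses.CoincidenceRotationBootstrap.CurvatureAmnesia` (shared
verbatim with `ScalingWindowSplit.CurvatureAmnesia`): Σ5 ORIENTATION AMNESIA of the curvature species of every
weak-coupling Wilson limit carrying the OS guards, the lattice tie, non-triviality and the two gaps.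

**Lens: Wilson's exact angular-momentum (Ward / Schwinger–Dyson) identity.**  For a SEPARATED real family
`f` (compact, pairwise disjoint supports) rotate every test function in the `(x₀,x₁)`-plane,
`f^θ := f ∘ ρ_θ⁻¹` (`rotFamily`, `ρ_θ = planeRot 0 θ`), and read the renormalised Wilson curvature correlator
`θ ↦ ⟨∏ⱼ Φ_k(fⱼ^θ)⟩_k` (`rotCorrelator`).  Only the sampling `f(a_k ρ_{-θ} x)` depends on `θ`, so it is a smooth
function of `θ` whose derivative is MINUS the one-insertion LATTICE WARD FUNCTIONAL
`W_k(θ; f) := Σᵢ ⟨Φ_k(f₁^θ) ⋯ Φ_k((L fᵢ)^θ) ⋯ Φ_k(f_n^θ)⟩_k` (`wardFunctional`, `L = x₁∂₀ − x₀∂₁ = rotGen`).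
The registered stubs (v4; (C), (T), (U) and the funnel are LANDED and imported):

* `stub_wardNullity_two_le` — (W₂) THE HARD STUB (open-problem): the cycle-1 Ward stub (W₀) restricted to its
  non-degenerate arities `n ≥ 2` — under the crux's hypotheses VERBATIM (`hW`, guards, tie, non-triviality, gaps; Borel
  structure of `G` as instance binders), for every `n ≥ 2` and every separated real family `f` the angle-`0` Ward
  functional `W_k(f) = Σᵢ ⟨Φ_k(f₁) ⋯ Φ_k(L fᵢ) ⋯ Φ_k(f_n)⟩_k → 0`.  By the tie this is the rotation-Ward identity
  `Σᵢ 𝔖ₙ(f₁⊗⋯⊗Lfᵢ⊗⋯⊗f_n) = 0` of the curvature-species Schwinger functions of the Wilson limit on separated tensors — the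
  non-perturbative rotation-restoration statement of weak-coupling lattice YM₄ (no proof in print).  Intended engine
  (idea card): summation by parts on `ℤ⁴` and the Schwinger–Dyson equations of Wilson's measure express `W_k` as the
  correlator of the ROTATION DEFECT of the Wilson action (`BULK + CONTACT + SEAM`); the antisymmetrised first moment
  projects onto the `Λ²`-channel, where pure gauge theory has no gauge-invariant local operator below dimension 6,
  leaving two powers of UV slack in the bulk and a lattice-scale mixing coefficient `c_k = O(g₀²(a_k)) → 0` at the
  insertion sites; the lattice gap gives the IR summability of the moment sum.
  **Certificate (v6, LANDED p157344, `Theorems/ScalingWindowSplitCurvatureAmnesiaIffWardNullity.lean`):**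
  `curvatureAmnesia_iff_wardNullity_two_le : CurvatureAmnesia ↔ (W₂)` — the converse of the funnel: the crux's Σ5 clause
  and the proper-hypercubic guard give invariance under every `(x₀,x₁)`-rotation (landed density upgrade), the tie makes
  the rotated correlator and the rotated Ward functional converge pointwise in the angle to CONSTANTS, the landed angle
  calculus identifies the second as minus the derivative of the first, and an Osgood–Baire uniform-boundedness interval
  with FTC + dominated convergence forces the constant to vanish (`wardNullity_of_planeInvariance`,
  `limit_of_derivs_eq_zero`).  So (W₂) is not a weakening: no reshaping inside this line can shrink the open residue.
* `stub_wardNullity_one` — (W₁) LANDED p155284 (wave 1): the degenerate arity `n = 1`, from the tie ALONE — the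
  lattice one-point function of `L f₀` is `κ_k · a_k⁴Σ_y (Lf₀)(a_k y)` (`latticeSchwinger_one_eq`), `κ_k` converges by the
  tie at one bump (`tendsto_riemannSum_box`), and `a_k⁴Σ_y (Lf₀)(a_k y) → ∫ L f₀ = 0`.  (Degree `0` is an empty sum and
  is discharged inside the composition.)
* `stub_uniformOfPointwise` — (U) LANDED p151760 (+ prep p151429): the TIE (pointwise boundedness in `k` ⇒
  multilinear Banach–Steinhaus on `∏ᵢ 𝓢_{Kᵢ}`, `Kᵢ` fixed pairwise disjoint compacts ⇒ equicontinuity) upgrades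
  pointwise Ward nullity on every separated family to nullity UNIFORM in the rotation angle on compact intervals.
* `stub_angleCalculus` — (C) LANDED p147637: `HasDerivAt (θ ↦ ⟨∏Φ_k(fⱼ^θ)⟩_k) (−W_k(θ; f)) θ`.
* `stub_separatedTensorsTotal` — (T) LANDED p146869: separated real tensors are total in `⁰𝒮`.
* funnel `stub_cruxOfWardNullity` — LANDED p152241 (`Theorems/ScalingWindowSplitCurvatureAmnesiaOfWardNullity.lean`):
  `(W₀, all arities) → ScalingWindowSplit.CurvatureAmnesia`.

Composition: `wardNullity_of_stubs : (W₁) → (W₂) → (W₀)` (cases on the degree) and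
`CurvatureAmnesia_of h₁ h₂ := stub_cruxOfWardNullity (wardNullity_of_stubs h₁ h₂)` — kernel-checked with no `sorry`
outside the two stubs; the funnel's steps:
1. mean-value inequality on `[-|θ|, |θ|]` + uniform nullity ⇒ `⟨∏Φ_k(fⱼ^θ)⟩_k − ⟨∏Φ_k(fⱼ)⟩_k → 0`;
2. the TIE at `f` and at `f^θ` identifies the two limits: `S n (F ∘ ρ_θ⁻¹) = S n F` on separated real tensors, every `θ`;
3. totality (T) lifts this to `⁰𝒮`;
4. the Σ5 rotation is `Q_B⁻¹ ∘ ρ_θ ∘ Q_B` with `cos θ = 3/5`, `sin θ = −4/5` and the proper signed permutation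
   `Q_B : e₀ ↔ e₂, e₁ ↔ e₃` (landed `QB_spec`), so proper-hypercubic invariance (twice) and step 3 give the Σ5 clause.

History: v1–v3 by the gen-0 lead (prover-line-stmt-QuantumFields-16192-0; v3 = crux closed modulo the single stub
`stub_wardNullity` = (W₀), outcome promote-stub); v4 by the gen-1 continuation lead: (W₀) split by arity into
(W₁) (LANDED p155284, wave 1) and (W₂) (open, the lead's), composition re-checked; v5: (W₁) imported, sorries = 1;
v6 (continuation lead c2, cycle 3): the equivalence certificate `CurvatureAmnesia ↔ (W₂)` LANDED (p157344) and
imported (`curvatureAmnesia_iff_stub_wardNullity_two_le` below links it to the registered alias); sorries = 1 = (W₂);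
v7 (continuation lead c3, cycle 4): unchanged composition and stub (re-registered); see `Lines/WardDefectSketch-c3.md`;
v8 (this file, continuation lead c4, cycle 5): unchanged composition and crux stub; engine-prerequisite sub-goals listed in §4.
Re-typed by the lead from the idea card `Ideas/ward-defect-weak-coupling.md` (every signature printed there) and the
tree lines `Lines/birth.lean`, `Lines/mirror_boost_transfer.lean`: the ideator's `WardDefectSketch.lean` lives in the
gate evidence store, which is not mounted in the lead's jail (docs/m5/notes/framework-gaps-2026-08-17-g33.md §4(iv)).
Deviation from the card: `AngleCalculus` drops the idle clause `Continuous (wardFunctional …)` (the composition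
uses the mean-value inequality, not the fundamental theorem of calculus).

Negative knowledge honoured: no `Disproof.lean` for this crux yet (`ledger crux ls`, 2026-08-17); `ledger negatives`
nearby entry `DiagonalMirrorRP` — no stub asserts reflection positivity in any frame; the model-blind zoo
(`CurvatureBoostCovariance.Negative`, `NPointIsotropy.Negative`) has no `k`-side, while the hard stub is a
statement about Wilson lattice correlators along the given scheme on separated real tests only.
-/

noncomputable section

namespace Summit.QuantumFields.YangMills.Cruxes.CurvatureAmnesia.WardDefect

open scoped BigOperators Topology SchwartzMap LineDeriv
open Filter
open Literature.MathematicalPhysics.QuantumLattice Literature.MathematicalPhysics.AQFT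
  Literature.MathematicalPhysics.QuantumFieldTheory
open Summit.QuantumFields.YangMills.Theses.CoincidenceRotationBootstrap (CurvatureAmnesia)

/-- `ℝ⁴` (file-local notation). -/
local notation "E4" => EuclideanSpace ℝ (Fin 4)

/-! ## §0 Vocabulary (verbatim clauses of the crux; the Ward objects) -/

/-- The Σ5 rotation clause of the crux (verbatim): `R e₀ = e₀`, `R e₁ = e₁`, `R e₂ = (3e₂+4e₃)/5`,
`R e₃ = (−4e₂+3e₃)/5`. -/
def IsSigmaFive (R : E4 ≃ₗᵢ[ℝ] E4) : Prop :=
  R (EuclideanSpace.single 0 1) = EuclideanSpace.single 0 1 ∧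
    R (EuclideanSpace.single 1 1) = EuclideanSpace.single 1 1 ∧
      R (EuclideanSpace.single 2 1) =
          (3/5 : ℝ) • EuclideanSpace.single 2 1 + (4/5 : ℝ) • EuclideanSpace.single 3 1 ∧
        R (EuclideanSpace.single 3 1) =
          -((4/5 : ℝ) • EuclideanSpace.single 2 1) + (3/5 : ℝ) • EuclideanSpace.single 3 1

section Guards

variable {ι : Type}

/-- The guard package of the crux (its second hypothesis, verbatim): E0 (normalisation, hermiticity), E0',
E2, E3, E4, translation invariance and proper-hypercubic invariance on `⁰𝒮`. -/
def Guards (S : LabelledSchwingerFamily ι E4) : Prop :=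
  S.IsNormalized ∧ S.IsHermitian ∧ S.HasLinearGrowth ∧ S.IsReflectionPositive ∧ S.IsSymmetric ∧
    S.HasClusterProperty ∧
    (∀ (n : ℕ) (k : Fin n → ι) (a : E4) (F : 𝓢((Fin n → E4), ℂ)), IsOffDiagonal F →
      S n k (translateMulti a F) = S n k F) ∧
    (∀ (n : ℕ) (k : Fin n → ι) (R : E4 ≃ₗᵢ[ℝ] E4), LinearMap.det (R.toLinearEquiv : E4 →ₗ[ℝ] E4) = 1 →
      (∀ i : Fin 4, ∃ j : Fin 4, R (EuclideanSpace.single i 1) = EuclideanSpace.single j 1 ∨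
        R (EuclideanSpace.single i 1) = -EuclideanSpace.single j 1) →
      ∀ F : 𝓢((Fin n → E4), ℂ), IsOffDiagonal F → S n k (linActMulti R F) = S n k F)

end Guards

section Lattice

variable {G : Type} [Group G] [TopologicalSpace G] [IsTopologicalGroup G] [CompactSpace G]
  [MeasurableSpace G] [BorelSpace G]

/-- The lattice TIE of the crux (its third hypothesis, verbatim = the body of `IsYangMillsFor`): `S` is the
`k → ∞` limit of the renormalised joint Wilson lattice `n`-point functions along `sch` on off-diagonal real
tensors, `n ≠ 0`. -/
def IsLatticeLimit (r : LatticeRep G) (sch : SpeciesScheme (YMSpecies G))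
    (S : LabelledSchwingerFamily (YMSpecies G) E4) : Prop :=
  ∀ (n : ℕ), n ≠ 0 → ∀ (σ : Fin n → YMSpecies G) (f : Fin n → 𝓢(E4, ℝ)) (F : 𝓢((Fin n → E4), ℂ)),
    IsTensorOf F (fun i => ofRealTest (f i)) → IsOffDiagonal F →
      Tendsto (fun k : ℕ => ((latticeSchwinger r.ρ sch (fun s => s.F) k n σ f : ℝ) : ℂ)) atTop
        (𝓝 (S n σ F))

/-- Non-triviality of the curvature species (the crux's fourth hypothesis, verbatim). -/
def CurvatureNontrivial (r : LatticeRep G) (S : LabelledSchwingerFamily (YMSpecies G) E4) : Prop :=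
  ∃ (F₁ G₁ : 𝓢((Fin 1 → E4), ℂ)) (H₁ : 𝓢((Fin (1 + 1) → E4), ℂ)),
    IsTimeOrdered F₁ ∧ IsTimeOrdered G₁ ∧ IsAppendTensorOf H₁ (osAdjoint F₁) G₁ ∧
      S (1 + 1) (fun _ => r.curvature) H₁ ≠
        S 1 (fun _ => r.curvature) (osAdjoint F₁) * S 1 (fun _ => r.curvature) G₁

/-- Continuum and volume-uniform lattice mass gaps (the crux's fifth hypothesis, verbatim). -/
def HasGaps (r : LatticeRep G) (sch : SpeciesScheme (YMSpecies G))
    (S : LabelledSchwingerFamily (YMSpecies G) E4) : Prop :=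
  ∃ Δ : ℝ, 0 < Δ ∧ S.HasMassGap Δ ∧ HasLatticeMassGap r sch Δ

end Lattice

/-- A SEPARATED family of real one-point test functions: compactly supported, pairwise disjoint supports
(so every tensor `f₁ ⊗ ⋯ ⊗ fₙ` vanishes near the coincidence locus, `IsSeparated.isOffDiagonal`). -/
def IsSeparated {n : ℕ} (f : Fin n → 𝓢(E4, ℝ)) : Prop :=
  (∀ i, HasCompactSupport (f i : E4 → ℝ)) ∧
    ∀ i j, i ≠ j → Disjoint (tsupport (f i : E4 → ℝ)) (tsupport (f j : E4 → ℝ))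

/-- The rotation of the `(x₀,x₁)`-plane by the angle `θ` (tree `planeRot 0 θ`:
`e₀ ↦ cos θ e₀ − sin θ e₁`, `e₁ ↦ sin θ e₀ + cos θ e₁`, `e₂, e₃` fixed). -/
abbrev rot (θ : ℝ) : E4 ≃ₗᵢ[ℝ] E4 := planeRot (d := 3) 0 θ

/-- The rotated family `f^θ := (fⱼ ∘ ρ_θ⁻¹)ⱼ` (`linActTest (rot θ)` on every member). -/
def rotFamily {n : ℕ} (f : Fin n → 𝓢(E4, ℝ)) (θ : ℝ) : Fin n → 𝓢(E4, ℝ) :=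
  fun j => linActTest (rot θ) (f j)

/-- The rotation generator of the `(x₀,x₁)`-plane on test functions, `L f = x₁ ∂₀ f − x₀ ∂₁ f`, normalised so
that `d/dθ (f ∘ ρ_θ⁻¹) = −(L f) ∘ ρ_θ⁻¹` for the tree's `planeRot 0 θ`. -/
def rotGen (f : 𝓢(E4, ℝ)) : 𝓢(E4, ℝ) :=
  SchwartzMap.smulLeftCLM ℝ (fun x : E4 => x 1) (∂_{(EuclideanSpace.single 0 1 : E4)} f) -
    SchwartzMap.smulLeftCLM ℝ (fun x : E4 => x 0) (∂_{(EuclideanSpace.single 1 1 : E4)} f)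

section Ward

variable {G : Type} [Group G] [TopologicalSpace G] [IsTopologicalGroup G] [CompactSpace G]
  [MeasurableSpace G] [BorelSpace G]

/-- The rotated curvature correlator `θ ↦ ⟨∏ⱼ Φ_k(fⱼ^θ)⟩_k` (renormalised Wilson lattice `n`-point function of
the all-curvature string at step `k`, smeared against the rotated family). -/
def rotCorrelator (r : LatticeRep G) (sch : SpeciesScheme (YMSpecies G)) (k n : ℕ)
    (f : Fin n → 𝓢(E4, ℝ)) (θ : ℝ) : ℝ :=
  latticeSchwinger r.ρ sch (fun s => s.F) k n (fun _ => r.curvature) (rotFamily f θ)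

/-- The **lattice Ward functional** `W_k(θ; f) = Σᵢ ⟨Φ_k(f₁^θ) ⋯ Φ_k((L fᵢ)^θ) ⋯ Φ_k(f_n^θ)⟩_k`: one insertion of
the rotation generator, every test function rotated by `θ`; `= −d/dθ ⟨∏ⱼ Φ_k(fⱼ^θ)⟩_k` (`AngleCalculus`). -/
def wardFunctional (r : LatticeRep G) (sch : SpeciesScheme (YMSpecies G)) (k n : ℕ)
    (f : Fin n → 𝓢(E4, ℝ)) (θ : ℝ) : ℝ :=
  ∑ i : Fin n, latticeSchwinger r.ρ sch (fun s => s.F) k n (fun _ => r.curvature)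
    (Function.update (rotFamily f θ) i (linActTest (rot θ) (rotGen (f i))))

end Ward

/-! ## §1 The named statements of the line -/

/-- **(W) Uniform Ward nullity** (THE hard stub; the idea's statement, lattice side).  Under the crux's
hypotheses verbatim, for every separated real family `f` and every `Θ`, the lattice Ward functional tends to `0`
uniformly in `θ ∈ [-Θ, Θ]` as `k → ∞`. -/
def UniformWardNullity : Prop :=
  ∀ (G : Type) [Group G] [TopologicalSpace G] [IsTopologicalGroup G] [CompactSpace G],
    IsCompactSimpleLieGroup G →
      letI : MeasurableSpace G := borel G
      haveI : BorelSpace G := ⟨rfl⟩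
      ∀ (r : LatticeRep G) (sch : SpeciesScheme (YMSpecies G))
        (S : LabelledSchwingerFamily (YMSpecies G) E4),
        sch.HasWeakCouplingLimit → Guards S → IsLatticeLimit r sch S → CurvatureNontrivial r S →
          HasGaps r sch S →
            ∀ (n : ℕ) (f : Fin n → 𝓢(E4, ℝ)), IsSeparated f →
              ∀ Θ : ℝ, TendstoUniformlyOn (fun k θ => wardFunctional r sch k n f θ) (fun _ => 0) atTop
                (Set.Icc (-Θ) Θ)

/-- **(C) Angle calculus** (support): the rotated lattice correlator is differentiable in the angle with
derivative minus the Ward functional, for every group, representation, scheme, step, arity and real family. -/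
def AngleCalculus : Prop :=
  ∀ (G : Type) [Group G] [TopologicalSpace G] [IsTopologicalGroup G] [CompactSpace G] [MeasurableSpace G]
    [BorelSpace G] (r : LatticeRep G) (sch : SpeciesScheme (YMSpecies G)) (k n : ℕ)
    (f : Fin n → 𝓢(E4, ℝ)) (θ : ℝ),
    HasDerivAt (rotCorrelator r sch k n f) (-(wardFunctional r sch k n f θ)) θ

/-- **(T) Separated real tensors are total in `⁰𝒮`** (support; verbatim the registered S2 of `Lines/birth.lean`).
Two continuous linear functionals on `𝓢((ℝ⁴)ⁿ, ℂ)` agreeing on the complexified real tensors with compactly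
supported, pairwise disjoint factors agree on every test function flat on the coincidence locus. -/
def SeparatedTensorsTotal : Prop :=
  ∀ (n : ℕ) (T₁ T₂ : 𝓢((Fin n → E4), ℂ) →L[ℂ] ℂ),
    (∀ f : Fin n → 𝓢(E4, ℝ), IsSeparated f →
      ∀ F : 𝓢((Fin n → E4), ℂ), IsTensorOf F (fun i => ofRealTest (f i)) → T₁ F = T₂ F) →
      ∀ F : 𝓢((Fin n → E4), ℂ), IsOffDiagonal F → T₁ F = T₂ F

/-! ## §2 The registered stubs (the ONLY `sorry`s of this file)

Each stub is stated in EXPANDED form over importable vocabulary only (Mathlib + `Literature.*`: `latticeSchwinger`,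
`linActTest`, `planeRot`, `SchwartzMap.smulLeftCLM`, `LineDeriv.lineDerivOp`, `IsTensorOf`, `ofRealTest`,
`IsOffDiagonal`, …), so that a worker's helper file under `Theorems/` proves it VERBATIM as a pure proof without
re-declaring any definition of this (non-importable) workfile; `stub_X` is definitionally the named statement `X` of §1
(`X_iff_stub : X ↔ <expanded>` is `Iff.rfl`). -/

/-! (W₁) `stub_wardNullity_one` is LANDED (imported): `Theorems/ScalingWindowSplitCurvatureAmnesiaStubWardNullityOne.lean`
(p155284, wave 1 of the gen-1 lead; same namespace, registered signature verbatim; by-products `integral_rotationGenerator_eq_zero :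
∫ (x₁∂₀g − x₀∂₁g) = 0`, `integral_coord_mul_lineDerivOp_eq_zero`). -/

/-- **(W₂) Ward nullity in degrees `n ≥ 2`** — THE hard stub (open-problem) after the cycle-2 RESHAPE: the registered
Ward stub of cycle 1 restricted to its non-degenerate arities.  Under the crux's hypotheses verbatim, for every `n ≥ 2`
and every SEPARATED real family `f` (compact, pairwise disjoint supports) the one-insertion lattice Ward functional
`W_k(f) = Σᵢ ⟨Φ_k(f₁) ⋯ Φ_k(L fᵢ) ⋯ Φ_k(f_n)⟩_k` (`L = x₁∂₀ − x₀∂₁`) tends to `0` as `k → ∞`.  By the tie this is the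
rotation-Ward identity `Σᵢ 𝔖ₙ(f₁ ⊗ ⋯ ⊗ Lfᵢ ⊗ ⋯ ⊗ f_n) = 0` of the curvature-species Schwinger functions of the
weak-coupling Wilson limit on separated tensors — the non-perturbative rotation-restoration statement of lattice
Yang–Mills theory (Symanzik: the W(B₄)-scalar O(4)-breaking operators have dimension ≥ 6), for which no proof is in
print; intended engine as on the idea card (exact Schwinger–Dyson identity `W = BULK + CONTACT + SEAM`, Λ²-selection
rule, two powers of UV slack in the bulk, lattice-scale mixing `c_k = O(g₀²(a_k)) → 0` at the sites, IR from the gap). -/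
theorem stub_wardNullity_two_le :
    ∀ (G : Type) [Group G] [TopologicalSpace G] [IsTopologicalGroup G] [CompactSpace G] [MeasurableSpace G]
      [BorelSpace G], IsCompactSimpleLieGroup G →
        ∀ (r : LatticeRep G) (sch : SpeciesScheme (YMSpecies G))
          (S : LabelledSchwingerFamily (YMSpecies G) (EuclideanSpace ℝ (Fin 4))),
          sch.HasWeakCouplingLimit →
            (S.IsNormalized ∧ S.IsHermitian ∧ S.HasLinearGrowth ∧ S.IsReflectionPositive ∧ S.IsSymmetric ∧
              S.HasClusterProperty ∧
              (∀ (n : ℕ) (k : Fin n → YMSpecies G) (a : EuclideanSpace ℝ (Fin 4))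
                (F : 𝓢((Fin n → EuclideanSpace ℝ (Fin 4)), ℂ)), IsOffDiagonal F →
                  S n k (translateMulti a F) = S n k F) ∧
              (∀ (n : ℕ) (k : Fin n → YMSpecies G)
                (R : EuclideanSpace ℝ (Fin 4) ≃ₗᵢ[ℝ] EuclideanSpace ℝ (Fin 4)),
                LinearMap.det (R.toLinearEquiv : EuclideanSpace ℝ (Fin 4) →ₗ[ℝ] EuclideanSpace ℝ (Fin 4)) = 1 →
                (∀ i : Fin 4, ∃ j : Fin 4, R (EuclideanSpace.single i 1) = EuclideanSpace.single j 1 ∨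
                  R (EuclideanSpace.single i 1) = -EuclideanSpace.single j 1) →
                ∀ F : 𝓢((Fin n → EuclideanSpace ℝ (Fin 4)), ℂ), IsOffDiagonal F →
                  S n k (linActMulti R F) = S n k F)) →
            (∀ (n : ℕ), n ≠ 0 → ∀ (σ : Fin n → YMSpecies G) (f : Fin n → 𝓢(EuclideanSpace ℝ (Fin 4), ℝ))
              (F : 𝓢((Fin n → EuclideanSpace ℝ (Fin 4)), ℂ)),
              IsTensorOf F (fun i => ofRealTest (f i)) → IsOffDiagonal F →
                Tendsto (fun k : ℕ => ((latticeSchwinger r.ρ sch (fun s => s.F) k n σ f : ℝ) : ℂ)) atTop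
                  (𝓝 (S n σ F))) →
            (∃ (F₁ G₁ : 𝓢((Fin 1 → EuclideanSpace ℝ (Fin 4)), ℂ))
                (H₁ : 𝓢((Fin (1 + 1) → EuclideanSpace ℝ (Fin 4)), ℂ)),
              IsTimeOrdered F₁ ∧ IsTimeOrdered G₁ ∧ IsAppendTensorOf H₁ (osAdjoint F₁) G₁ ∧
                S (1 + 1) (fun _ => r.curvature) H₁ ≠
                  S 1 (fun _ => r.curvature) (osAdjoint F₁) * S 1 (fun _ => r.curvature) G₁) →
            (∃ Δ : ℝ, 0 < Δ ∧ S.HasMassGap Δ ∧ HasLatticeMassGap r sch Δ) →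
              ∀ (n : ℕ), 2 ≤ n → ∀ (f : Fin n → 𝓢(EuclideanSpace ℝ (Fin 4), ℝ)),
                ((∀ i, HasCompactSupport (f i : EuclideanSpace ℝ (Fin 4) → ℝ)) ∧
                  ∀ i j, i ≠ j → Disjoint (tsupport (f i : EuclideanSpace ℝ (Fin 4) → ℝ))
                    (tsupport (f j : EuclideanSpace ℝ (Fin 4) → ℝ))) →
                Tendsto
                  (fun k : ℕ => ∑ i : Fin n,
                    latticeSchwinger r.ρ sch (fun s => s.F) k n (fun _ => r.curvature)
                      (Function.update f i
                        (SchwartzMap.smulLeftCLM ℝ (fun x : EuclideanSpace ℝ (Fin 4) => x 1)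
                            (LineDeriv.lineDerivOp (EuclideanSpace.single (0 : Fin 4) (1 : ℝ) :
                              EuclideanSpace ℝ (Fin 4)) (f i)) -
                          SchwartzMap.smulLeftCLM ℝ (fun x : EuclideanSpace ℝ (Fin 4) => x 0)
                            (LineDeriv.lineDerivOp (EuclideanSpace.single (1 : Fin 4) (1 : ℝ) :
                              EuclideanSpace ℝ (Fin 4)) (f i)))))
                  atTop (𝓝 0) := by
  sorry

/-! (U) `stub_uniformOfPointwise` is LANDED (imported): `Theorems/ScalingWindowSplitCurvatureAmnesiaStubUniformOfPointwise.lean`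
(p151760; prep lemmas `…StubUniformOfPointwisePrep.lean` p151429 — multilinear Banach–Steinhaus on the cut-off family), same
namespace, registered signature verbatim. -/

/-! (C) `stub_angleCalculus` and (T) `stub_separatedTensorsTotal` are LANDED (imported):
`Theorems/ScalingWindowSplitCurvatureAmnesiaStubAngleCalculus.lean` (p147637) and
`Theorems/ScalingWindowSplitCurvatureAmnesiaStubSeparatedTensorsTotal.lean` (p146869), same namespace, registered
signatures verbatim.  The FUNNEL `stub_cruxOfWardNullity : (W₀, all arities) → ScalingWindowSplit.CurvatureAmnesia` is LANDED
(`Theorems/ScalingWindowSplitCurvatureAmnesiaOfWardNullity.lean`, p152241). -/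

/-! ### Name-keyed aliases of the open statements (hypotheses of the composition) -/
namespace Registered

/-- Alias of the cycle-1 Ward stub (W₀, ALL arities) — no longer a registered stub, but the verbatim hypothesis of the landed
funnel `stub_cruxOfWardNullity`; derived below from (W₁) and (W₂) (`wardNullity_of_stubs`). -/
abbrev stub_wardNullity : Prop :=
  ∀ (G : Type) [Group G] [TopologicalSpace G] [IsTopologicalGroup G] [CompactSpace G] [MeasurableSpace G]
    [BorelSpace G], IsCompactSimpleLieGroup G →
      ∀ (r : LatticeRep G) (sch : SpeciesScheme (YMSpecies G))
        (S : LabelledSchwingerFamily (YMSpecies G) (EuclideanSpace ℝ (Fin 4))),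
        sch.HasWeakCouplingLimit →
          (S.IsNormalized ∧ S.IsHermitian ∧ S.HasLinearGrowth ∧ S.IsReflectionPositive ∧ S.IsSymmetric ∧
            S.HasClusterProperty ∧
            (∀ (n : ℕ) (k : Fin n → YMSpecies G) (a : EuclideanSpace ℝ (Fin 4))
              (F : 𝓢((Fin n → EuclideanSpace ℝ (Fin 4)), ℂ)), IsOffDiagonal F →
                S n k (translateMulti a F) = S n k F) ∧
            (∀ (n : ℕ) (k : Fin n → YMSpecies G)
              (R : EuclideanSpace ℝ (Fin 4) ≃ₗᵢ[ℝ] EuclideanSpace ℝ (Fin 4)),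
              LinearMap.det (R.toLinearEquiv : EuclideanSpace ℝ (Fin 4) →ₗ[ℝ] EuclideanSpace ℝ (Fin 4)) = 1 →
              (∀ i : Fin 4, ∃ j : Fin 4, R (EuclideanSpace.single i 1) = EuclideanSpace.single j 1 ∨
                R (EuclideanSpace.single i 1) = -EuclideanSpace.single j 1) →
              ∀ F : 𝓢((Fin n → EuclideanSpace ℝ (Fin 4)), ℂ), IsOffDiagonal F →
                S n k (linActMulti R F) = S n k F)) →
          (∀ (n : ℕ), n ≠ 0 → ∀ (σ : Fin n → YMSpecies G) (f : Fin n → 𝓢(EuclideanSpace ℝ (Fin 4), ℝ))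
            (F : 𝓢((Fin n → EuclideanSpace ℝ (Fin 4)), ℂ)),
            IsTensorOf F (fun i => ofRealTest (f i)) → IsOffDiagonal F →
              Tendsto (fun k : ℕ => ((latticeSchwinger r.ρ sch (fun s => s.F) k n σ f : ℝ) : ℂ)) atTop
                (𝓝 (S n σ F))) →
          (∃ (F₁ G₁ : 𝓢((Fin 1 → EuclideanSpace ℝ (Fin 4)), ℂ))
              (H₁ : 𝓢((Fin (1 + 1) → EuclideanSpace ℝ (Fin 4)), ℂ)),
            IsTimeOrdered F₁ ∧ IsTimeOrdered G₁ ∧ IsAppendTensorOf H₁ (osAdjoint F₁) G₁ ∧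
              S (1 + 1) (fun _ => r.curvature) H₁ ≠
                S 1 (fun _ => r.curvature) (osAdjoint F₁) * S 1 (fun _ => r.curvature) G₁) →
          (∃ Δ : ℝ, 0 < Δ ∧ S.HasMassGap Δ ∧ HasLatticeMassGap r sch Δ) →
            ∀ (n : ℕ) (f : Fin n → 𝓢(EuclideanSpace ℝ (Fin 4), ℝ)),
              ((∀ i, HasCompactSupport (f i : EuclideanSpace ℝ (Fin 4) → ℝ)) ∧
                ∀ i j, i ≠ j → Disjoint (tsupport (f i : EuclideanSpace ℝ (Fin 4) → ℝ))
                  (tsupport (f j : EuclideanSpace ℝ (Fin 4) → ℝ))) →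
              Tendsto
                (fun k : ℕ => ∑ i : Fin n,
                  latticeSchwinger r.ρ sch (fun s => s.F) k n (fun _ => r.curvature)
                    (Function.update f i
                      (SchwartzMap.smulLeftCLM ℝ (fun x : EuclideanSpace ℝ (Fin 4) => x 1)
                          (LineDeriv.lineDerivOp (EuclideanSpace.single (0 : Fin 4) (1 : ℝ) :
                            EuclideanSpace ℝ (Fin 4)) (f i)) -
                        SchwartzMap.smulLeftCLM ℝ (fun x : EuclideanSpace ℝ (Fin 4) => x 0)
                          (LineDeriv.lineDerivOp (EuclideanSpace.single (1 : Fin 4) (1 : ℝ) :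
                            EuclideanSpace ℝ (Fin 4)) (f i)))))
                atTop (𝓝 0)

/-- Alias of the registered stub (W₁) `stub_wardNullity_one`, keyed by its name: the expanded statement verbatim. -/
abbrev stub_wardNullity_one : Prop :=
  ∀ (G : Type) [Group G] [TopologicalSpace G] [IsTopologicalGroup G] [CompactSpace G] [MeasurableSpace G]
    [BorelSpace G] (r : LatticeRep G) (sch : SpeciesScheme (YMSpecies G))
    (S : LabelledSchwingerFamily (YMSpecies G) (EuclideanSpace ℝ (Fin 4))),
    (∀ (n : ℕ), n ≠ 0 → ∀ (σ : Fin n → YMSpecies G) (f : Fin n → 𝓢(EuclideanSpace ℝ (Fin 4), ℝ))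
      (F : 𝓢((Fin n → EuclideanSpace ℝ (Fin 4)), ℂ)),
      IsTensorOf F (fun i => ofRealTest (f i)) → IsOffDiagonal F →
        Tendsto (fun k : ℕ => ((latticeSchwinger r.ρ sch (fun s => s.F) k n σ f : ℝ) : ℂ)) atTop
          (𝓝 (S n σ F))) →
    ∀ (f : Fin 1 → 𝓢(EuclideanSpace ℝ (Fin 4), ℝ)),
      Tendsto
        (fun k : ℕ => ∑ i : Fin 1,
          latticeSchwinger r.ρ sch (fun s => s.F) k 1 (fun _ => r.curvature)
            (Function.update f i
              (SchwartzMap.smulLeftCLM ℝ (fun x : EuclideanSpace ℝ (Fin 4) => x 1)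
                  (LineDeriv.lineDerivOp (EuclideanSpace.single (0 : Fin 4) (1 : ℝ) :
                    EuclideanSpace ℝ (Fin 4)) (f i)) -
                SchwartzMap.smulLeftCLM ℝ (fun x : EuclideanSpace ℝ (Fin 4) => x 0)
                  (LineDeriv.lineDerivOp (EuclideanSpace.single (1 : Fin 4) (1 : ℝ) :
                    EuclideanSpace ℝ (Fin 4)) (f i)))))
        atTop (𝓝 0)

/-- Alias of the registered hard stub (W₂) `stub_wardNullity_two_le`, keyed by its name: the expanded statement verbatim. -/
abbrev stub_wardNullity_two_le : Prop :=
  ∀ (G : Type) [Group G] [TopologicalSpace G] [IsTopologicalGroup G] [CompactSpace G] [MeasurableSpace G]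
    [BorelSpace G], IsCompactSimpleLieGroup G →
      ∀ (r : LatticeRep G) (sch : SpeciesScheme (YMSpecies G))
        (S : LabelledSchwingerFamily (YMSpecies G) (EuclideanSpace ℝ (Fin 4))),
        sch.HasWeakCouplingLimit →
          (S.IsNormalized ∧ S.IsHermitian ∧ S.HasLinearGrowth ∧ S.IsReflectionPositive ∧ S.IsSymmetric ∧
            S.HasClusterProperty ∧
            (∀ (n : ℕ) (k : Fin n → YMSpecies G) (a : EuclideanSpace ℝ (Fin 4))
              (F : 𝓢((Fin n → EuclideanSpace ℝ (Fin 4)), ℂ)), IsOffDiagonal F →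
                S n k (translateMulti a F) = S n k F) ∧
            (∀ (n : ℕ) (k : Fin n → YMSpecies G)
              (R : EuclideanSpace ℝ (Fin 4) ≃ₗᵢ[ℝ] EuclideanSpace ℝ (Fin 4)),
              LinearMap.det (R.toLinearEquiv : EuclideanSpace ℝ (Fin 4) →ₗ[ℝ] EuclideanSpace ℝ (Fin 4)) = 1 →
              (∀ i : Fin 4, ∃ j : Fin 4, R (EuclideanSpace.single i 1) = EuclideanSpace.single j 1 ∨
                R (EuclideanSpace.single i 1) = -EuclideanSpace.single j 1) →
              ∀ F : 𝓢((Fin n → EuclideanSpace ℝ (Fin 4)), ℂ), IsOffDiagonal F →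
                S n k (linActMulti R F) = S n k F)) →
          (∀ (n : ℕ), n ≠ 0 → ∀ (σ : Fin n → YMSpecies G) (f : Fin n → 𝓢(EuclideanSpace ℝ (Fin 4), ℝ))
            (F : 𝓢((Fin n → EuclideanSpace ℝ (Fin 4)), ℂ)),
            IsTensorOf F (fun i => ofRealTest (f i)) → IsOffDiagonal F →
              Tendsto (fun k : ℕ => ((latticeSchwinger r.ρ sch (fun s => s.F) k n σ f : ℝ) : ℂ)) atTop
                (𝓝 (S n σ F))) →
          (∃ (F₁ G₁ : 𝓢((Fin 1 → EuclideanSpace ℝ (Fin 4)), ℂ))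
              (H₁ : 𝓢((Fin (1 + 1) → EuclideanSpace ℝ (Fin 4)), ℂ)),
            IsTimeOrdered F₁ ∧ IsTimeOrdered G₁ ∧ IsAppendTensorOf H₁ (osAdjoint F₁) G₁ ∧
              S (1 + 1) (fun _ => r.curvature) H₁ ≠
                S 1 (fun _ => r.curvature) (osAdjoint F₁) * S 1 (fun _ => r.curvature) G₁) →
          (∃ Δ : ℝ, 0 < Δ ∧ S.HasMassGap Δ ∧ HasLatticeMassGap r sch Δ) →
            ∀ (n : ℕ), 2 ≤ n → ∀ (f : Fin n → 𝓢(EuclideanSpace ℝ (Fin 4), ℝ)),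
              ((∀ i, HasCompactSupport (f i : EuclideanSpace ℝ (Fin 4) → ℝ)) ∧
                ∀ i j, i ≠ j → Disjoint (tsupport (f i : EuclideanSpace ℝ (Fin 4) → ℝ))
                  (tsupport (f j : EuclideanSpace ℝ (Fin 4) → ℝ))) →
              Tendsto
                (fun k : ℕ => ∑ i : Fin n,
                  latticeSchwinger r.ρ sch (fun s => s.F) k n (fun _ => r.curvature)
                    (Function.update f i
                      (SchwartzMap.smulLeftCLM ℝ (fun x : EuclideanSpace ℝ (Fin 4) => x 1)
                          (LineDeriv.lineDerivOp (EuclideanSpace.single (0 : Fin 4) (1 : ℝ) :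
                            EuclideanSpace ℝ (Fin 4)) (f i)) -
                        SchwartzMap.smulLeftCLM ℝ (fun x : EuclideanSpace ℝ (Fin 4) => x 0)
                          (LineDeriv.lineDerivOp (EuclideanSpace.single (1 : Fin 4) (1 : ℝ) :
                            EuclideanSpace ℝ (Fin 4)) (f i)))))
                atTop (𝓝 0)

end Registered

/-! ## §3 Composition (kernel-checked; no `sorry` below this line)

(W₁) and (W₂) give the cycle-1 Ward statement (W₀) in every arity (degree `0` is an empty sum), and everything between
(W₀) and the crux is LANDED: the funnel `Theorems/ScalingWindowSplitCurvatureAmnesiaOfWardNullity.lean` (p152241) proves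
`stub_cruxOfWardNullity : (W₀) → ScalingWindowSplit.CurvatureAmnesia` from the landed stubs (U) `stub_uniformOfPointwise`
(p151760, prep p151429), (C) `stub_angleCalculus` (p147637) and (T) `stub_separatedTensorsTotal` (p146869): uniformity in
the angle (multilinear Banach–Steinhaus), mean-value step, the tie at `f` and `f^θ`, totality, and the conjugation
`R_Σ5 = Q_B⁻¹ ∘ ρ_θ ∘ Q_B` (`cos θ = 3/5`, `sin θ = −4/5`, landed `QB_spec`) with proper-hypercubic invariance twice. -/

/-- **(W₀) from (W₁) and (W₂)**: the all-arity Ward statement by cases on the degree — `n = 0` is an empty sum,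
`n = 1` is (W₁) fed the tie, `n ≥ 2` is (W₂). -/
theorem wardNullity_of_stubs (h₁ : Registered.stub_wardNullity_one) (h₂ : Registered.stub_wardNullity_two_le) :
    Registered.stub_wardNullity := by
  intro G _ _ _ _ _ _ hG r sch S hW hax hconv hNT hgap n f hf
  rcases n with _ | _ | n
  · simp only [Finset.univ_eq_empty, Finset.sum_empty]
    exact tendsto_const_nhds
  · exact h₁ G r sch S hconv f
  · exact h₂ G hG r sch S hW hax hconv hNT hgap (n + 2) (by omega) f hf

/-- **The crux from the two open stubs** (concludes `CurvatureAmnesia` BY NAME): (W₁) + (W₂) ⇒ (W₀)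
(`wardNullity_of_stubs`) ⇒ the crux by the landed funnel `stub_cruxOfWardNullity` (the two route copies of the crux are
definitionally equal). -/
theorem CurvatureAmnesia_of (h₁ : Registered.stub_wardNullity_one) (h₂ : Registered.stub_wardNullity_two_le) :
    CurvatureAmnesia :=
  stub_cruxOfWardNullity (wardNullity_of_stubs h₁ h₂)

/-- The crux along this skeleton, from the registered stubs (the only `sorry` is inside `stub_wardNullity_two_le`;
`stub_wardNullity_one` is the LANDED theorem p155284). -/
theorem CurvatureAmnesia_skeleton : CurvatureAmnesia :=
  CurvatureAmnesia_of stub_wardNullity_one stub_wardNullity_two_le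

/-- **The open residue IS the crux** (v6, certificate LANDED p157344): `CurvatureAmnesia ↔ (W₂)`, the registered alias
being the landed statement verbatim. -/
theorem curvatureAmnesia_iff_stub_wardNullity_two_le :
    CurvatureAmnesia ↔ Registered.stub_wardNullity_two_le :=
  curvatureAmnesia_iff_wardNullity_two_le

/-- In particular the skeleton's only `sorry` is equivalent to its conclusion: any proof of (W₂) closes the crux
(`CurvatureAmnesia_of`) and any proof of the crux proves (W₂). -/
theorem stub_wardNullity_two_le_iff_skeleton :
    Registered.stub_wardNullity_two_le ↔ CurvatureAmnesia :=
  curvatureAmnesia_iff_stub_wardNullity_two_le.symm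

/-- (W) uniform Ward nullity (the named statement of §1) from the open stubs and the landed (U). -/
theorem uniformWardNullity_of_stubs (h₁ : Registered.stub_wardNullity_one)
    (h₂ : Registered.stub_wardNullity_two_le) : UniformWardNullity := by
  have hW := wardNullity_of_stubs h₁ h₂
  intro G _ _ _ _ hG
  letI : MeasurableSpace G := borel G
  haveI : BorelSpace G := ⟨rfl⟩
  intro r sch S hWk hax hconv hNT hgap n f hf Θ
  exact stub_uniformOfPointwise G r sch S hconv (hW G hG r sch S hWk hax hconv hNT hgap) n f hf Θ

/-! ### The shared crux under its other route name (`ScalingWindowSplit.CurvatureAmnesia`, item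
stmt-QuantumFields-16192 wanted_by both routes; the two route copies are verbatim and definitionally equal). -/

/-- Composition, concluding the copy `ScalingWindowSplit.CurvatureAmnesia` (sorry-free). -/
theorem CurvatureAmnesia_of_scalingWindowSplit (h₁ : Registered.stub_wardNullity_one)
    (h₂ : Registered.stub_wardNullity_two_le) :
    Summit.QuantumFields.YangMills.Theses.ScalingWindowSplit.CurvatureAmnesia :=
  stub_cruxOfWardNullity (wardNullity_of_stubs h₁ h₂)

/-- The skeleton under the name `ScalingWindowSplit.CurvatureAmnesia`. -/
theorem CurvatureAmnesia_proof_scalingWindowSplit :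
    Summit.QuantumFields.YangMills.Theses.ScalingWindowSplit.CurvatureAmnesia :=
  CurvatureAmnesia_skeleton

/-! ## §4 Engine-prerequisite sub-goals of cycle 5 (registered with `ledger workitem stub-add`, ALL LANDED `--supports`)

None of these lowers the sorry count (the only `sorry` is (W₂) ≡ crux); they are the definition-free bricks the card's
engine C⁺ = (W-exact) ∧ (N-bulk) ∧ (N-site) ∧ (IR) must start from, registered by NAME + closed signature on the item and
landed under `Summits/QuantumFields/YangMills/Theorems/ScalingWindowSplitCurvatureAmnesia*.lean` (namespace of this file):
* `latticeMassGap_allAxes` (p163636, `…LatticeMassGapAllAxes`) — (IR): `HasLatticeMassGap r sch Δ` transported from the time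
  axis to every axis by the exact hypercubic symmetry of Wilson's torus measure;
* `latticeSchwinger_translate_eventually` (p163777, `…LatticeTranslationCovariance`) — exact lattice translation covariance of
  `latticeSchwinger` on compactly supported families, for all large `k`;
* `tendsto_diffQuotient_schwartz` (p164236, `…SchwartzDifferenceQuotient`) — `t⁻¹(f(· + t v) − f) → ∂_v f` in `𝓢(ℝ⁴, ℝ)`;
* `lambdaTwo_selectionRule` (p163986, `…LambdaTwoSelectionRule`) — `Hom_{W⁺}(Sym²Λ², Λ²) = 0` in coordinates;
* `latticeSchwinger_update_diffQuotient_tendsto` (p165044, `…SlotEquicontinuity`) — under the TIE alone, `p·∂_v fᵢ` in one slot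
  of a separated family = the lattice difference quotient `p·a_k⁻¹(fᵢ(·+a_k v) − fᵢ)` up to `o(1)` (Banach–Steinhaus on `𝓢`);
* `smearedLatticeField_latticeRotGen` (p164957, `…LatticeRotationGenerator`) — exact summation by parts on the box:
  `Φ(D_a f) = −c a⁴ Σ_y f(ay)[y₁∇⁻₀O − y₀∇⁻₁O]_y`;
* `wardInsertion_latticeAngularMomentum_tendsto` (p165841, `…WardLatticeForm`) — (W-exact a): each Ward insertion
  `⟨…Φ_k(Lfᵢ)…⟩_k` equals MINUS the lattice angular-momentum-density insertion up to `o(1)`;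
* `hasDerivAt_actionDensity_torusLift_oneLink` (p165982, `…ActionDensityOneLinkDeriv`) — (W-exact b): the explicit one-link
  shift-derivative of the translated action density of the periodic lift (+ the smeared field, same file);
* `wilson_schwingerDyson_curvatureString` (p166551, `…CurvatureStringSD`) — (W-exact b): the one-link Schwinger–Dyson identity of
  p160811 for a string of smeared curvature fields, `∫ Σⱼ Φ'ⱼ ∏_{l≠j} Φ_l dμ_β = β ∫ (∏Φ_l) S' dμ_β`.
Definitions for the next layer: `Literature/MathematicalPhysics/QuantumFieldTheory/CloverStressTensor.lean` (p165510: clover leaves,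
clover field strength, the CCMP clover stress tensor `LatticeRep.cloverStress r μ ν : YMSpecies G`) and the bridge to Lüscher's
`flowedClover` / `lieProjection` (`CloverStressTensorBridge.lean`).  See `Lines/WardDefectSketch-c4.md` for the typed roadmap
((W-exact c) definitional; (IR) needs PAIR-UNIFORM clustering — a gap in the card's Leans-on; (N) open).
-/

end Summit.QuantumFields.YangMills.Cruxes.CurvatureAmnesia.WardDefect

end
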